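import Summits.BirchSwinnertonDyer.Rank1Residual.X11a.SelmerCompanionAuxiliaryTateLine
import Summits.BirchSwinnertonDyer.Rank1Residual.X11a.SelmerCompanionFlat
import HarnessLib

/-!
# Route (3e) SELMER COMPANION, XXXIX: SHAPE F in two halves — the bound `#Sel^(p)(F) ≤ p` from a
# closed rank-0 partner (flat count, any single loss), and the `E ~ F` assemblies taking that bound
# as input (class X11a = N7; cell `b2b-bsdres`, unit `b2b-bsdres-x11a`, gen 32)

HONEST FRAMING (run/shared/lean/b2b/bsd-rank1-residual/, verbatim in every file): the goal of the
cell is to DELETE the COMBINATION-SHAPED residual classes of the Birch–Swinnerton-Dyer formula for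
ALL analytic-rank `≤ 1` elliptic curves over `ℚ` — "full BSD formula for every rank `≤ 1` curve in
class `C`" assembled STRICTLY from published theorems — so that the rank-`≤ 1` remainder becomes
exactly the CONSTRUCTION-SHAPED classes, which are TYPED (missing-input `Prop`s), NOT attempted.
This is not "finishing BSD". CLASS-OWNERS.md: research routes; NO CLAIM BEYOND STATED CLASSES.
THEOREMS ONLY; nothing booked; no label moves. CONDITIONAL on the PUBLISHED binders GZK (`hGZK`),
Cassels–Tate (`hCT`), Tate's local Euler characteristic (`hEP`, Milne *ADT* I Thm. 2.8, in the
Tate-line half only), and on the per-pair finite data named; A40/A41 enter only through the kill /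
agreement lemmas the caller plugs in.

## What this file proves

Files XXXVI–XXXVIII bound the auxiliary curve's Selmer group through file XIX (the comparison
`F ~ A₀` loses only at `p`, where `F` is multiplicative and `A₀` good). For the census-v10 cells with
`E` NON-SPLIT at `p` (140946s1, 423168k1 @3) the auxiliary curve must be non-split at `p` too and
then AGREES with the good partner `A₀` at `p` (kind (v), file VI), while the single loss of `F ~ A₀`
sits at another place. This file separates the two halves of SHAPE F so that every such
configuration is a two-line composition:

* `natCard_selmerGroup_le_of_closed_rankZero_partner` — **the flat bound**: `A₀` CLOSED at `p`
  (`BSD(A₀,p)`), `r_an(A₀) = 0`, `p ∤ #Ш_an(A₀)`, `A₀[p]` irreducible (so `Sel^(p)(A₀) = 0`, file II);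
  `θ₀ : F[p] ≃ A₀[p]` equivariant; abstract agreement off `T₂` (kind (i) or any kind lemma, the place
  of `p` INCLUDED); then `#Sel^(p)(F/ℚ) ≤ ∏_{v∈T₂} #F(ℚ_v)[p]·#(ℤ_v/p)` (file XIII's strict count with
  its strictness hypothesis VACUOUS).
* `bsdp_of_auxiliary_kill_of_natCard_le` — **the `E ~ F` half with a kill place**: `E = W` rank
  `0`, `E[p]` irreducible, `p ∤ #Ш_an(E)`, `p` odd; `θ : E[p] ≃ F[p]`; `hle : #Sel^(p)(F) ≤ p` (from
  the flat bound above, or from file XXVII's count at `p`); abstract agreement off `T₁`; an abstract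
  kill hypothesis at `v₀` (files XIV / XVI / XXX); a rational point `g ∈ F(ℚ)` not `p`-divisible in
  `F(ℚ_{v₀})`; budget `∏_{T₁} ≤ p`. Then `BSD(E,p)`.
* `bsdp_of_auxiliary_tateLine_of_natCard_le` — **the `E ~ F` half at a full-torsion place**: as
  file XXXVIII (`Φ'`, `hq`, `hpt`, `hcert`), with `hle : #Sel^(p)(F) ≤ p` as input; budget
  `p·∏_{T₁} ≤ p`. Then `BSD(E,p)`.

Not a class theorem; nothing booked. References: [MazurRubin2004] §2.3; [Miller2011LMS] Def. 1.1;
[SilvermanAEC2009] VIII.§2, X.§4; [MilneADT2006] I Thm. 2.8; files II, XIII, XX, XXII, XXXII–XXXVIII;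
HOME/b2b-bsdres-x11a/REPORT-g32.md.
-/

set_option autoImplicit false

noncomputable section

open scoped Classical NNReal

open WeierstrassCurve Literature.NumberTheory.EllipticCurves
  Literature.NumberTheory.GaloisRepresentations Field NumberField IsDedekindDomain
  IsDedekindDomain.HeightOneSpectrum
  Literature.NumberTheory.EllipticCurves.Rank1Residual
  Literature.NumberTheory.EllipticCurves.Rank1Residual.Typed

namespace Summit.BirchSwinnertonDyer.Rank1Residual.X11a.SelmerCompanion

variable (W F A₀ : WeierstrassCurve ℚ) [W.IsElliptic] [F.IsElliptic] [A₀.IsElliptic] (p : ℕ)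
  [hp : Fact p.Prime]

/-! ## §1 The flat bound from a closed rank-0 partner -/

omit [W.IsElliptic] in
/-- **`#Sel^(p)(F) ≤ ∏_{T₂} #F(ℚ_v)[p]·#(ℤ_v/p)` from a CLOSED rank-`0` partner.** `A₀` with
`BSD(A₀,p)`, `r_an(A₀) = 0`, `p ∤ #Ш_an(A₀)`, `A₀[p]` irreducible has `Sel^(p)(A₀) = 0` (file II);
along an equivariant `θ₀ : F[p] ≃ A₀[p]` with agreement off `T₂` (kind (i) for `F`, or
`θ₀_* 𝓢_v(F) ≤ 𝓢_v(A₀)`), file XIII's strict count — whose strictness hypothesis is vacuous here —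
bounds `Sel^(p)(F)` by the local budget of `T₂` alone. `p` odd. No hypothesis at the place of `p`
beyond agreement or a charge. [cite: MazurRubin2004, §2.3] [cite: Miller2011LMS, §1 and Def. 1.1] -/
theorem natCard_selmerGroup_le_of_closed_rankZero_partner (hp2 : p ≠ 2)
    (hbsdA : BSDp A₀ p) (hrA : A₀.analyticRank = 0) (hirrA : Irr A₀ p) (hShaA : X11a.ShaAnUnit A₀ p)
    (θ₀ : geomTorsion F (p : ℤ) ≃+ geomTorsion A₀ (p : ℤ))
    (hθ₀ : ∀ (σ : absoluteGaloisGroup ℚ) (P : geomTorsion F (p : ℤ)), θ₀ (σ • P) = σ • θ₀ P)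
    (S₂ T₂ : Finset (HeightOneSpectrum (𝓞 ℚ))) (hTS₂ : T₂ ⊆ S₂)
    (hS₂ : ∀ v : HeightOneSpectrum (𝓞 ℚ), v ∉ S₂ →
      A₀.HasGoodReductionAt v ∧ F.HasGoodReductionAt v ∧ (p : 𝓞 ℚ) ∉ v.asIdeal)
    (hagree₂ : ∀ v ∈ S₂, v ∉ T₂ →
      ((p : 𝓞 ℚ) ∉ v.asIdeal ∧ Nat.card (nsmulAddMonoidHom p :
          (F.baseChange (v.adicCompletion ℚ)).toAffine.Point →+ _).ker = 1) ∨
      (∀ c ∈ selmerLocalKer F (v.adicCompletion ℚ) (p : ℤ),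
        h1Equiv θ₀ hθ₀ c ∈ selmerLocalKer A₀ (v.adicCompletion ℚ) (p : ℤ)))
    (v₁ : HeightOneSpectrum (𝓞 ℚ)) :
    Nat.card (F.selmerGroup (p : ℤ)) ≤
      ∏ v ∈ T₂, (Nat.card (nsmulAddMonoidHom p :
        (F.baseChange (v.adicCompletion ℚ)).toAffine.Point →+ _).ker *
          Nat.card (v.adicCompletionIntegers ℚ ⧸ Ideal.span {(p : v.adicCompletionIntegers ℚ)})) := by
  have hpp : p.Prime := hp.out
  have hn0 : (p : ℤ) ≠ 0 := by exact_mod_cast hpp.ne_zero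
  classical
  -- `Sel^(p)(A₀) = 0`
  have hSel₀ : Nat.card (A₀.selmerGroup (p : ℤ)) = 1 := by
    rw [natCard_selmerGroup_eq_pow_of_bsdp A₀ p hbsdA hShaA hirrA, hrA, pow_zero]
  haveI : Finite (A₀.selmerGroup (p : ℤ)) := A₀.finite_selmerGroup_holds hn0
  have hsub₀ : ∀ d ∈ A₀.selmerGroup (p : ℤ), d = 0 := by
    intro d hd
    have h1 := (Nat.card_eq_one_iff_unique.mp hSel₀).1
    have h := @Subsingleton.elim _ h1 (⟨d, hd⟩ : A₀.selmerGroup (p : ℤ)) ⟨0, zero_mem _⟩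
    exact congrArg Subtype.val h
  -- enlarge `T₂` by the kind-(i) places
  set T' := T₂ ∪ S₂.filter (fun v ↦ (p : 𝓞 ℚ) ∉ v.asIdeal ∧ Nat.card (nsmulAddMonoidHom p :
      (F.baseChange (v.adicCompletion ℚ)).toAffine.Point →+ _).ker = 1) with hT'
  have hT'S : T' ⊆ S₂ := Finset.union_subset hTS₂ (Finset.filter_subset _ _)
  have h1 := natCard_selmerGroup_le_of_congr_of_le_off_strict A₀ F hp2 θ₀ hθ₀ S₂ T' hT'S hS₂
    (fun v hv hvT c hc ↦ ?_) (v₀ := v₁) (fun c _ hcA ↦ hsub₀ _ hcA)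
  · refine h1.trans (le_of_eq ?_)
    have hsplit' : T' = T₂ ∪ (S₂.filter (fun v ↦ (p : 𝓞 ℚ) ∉ v.asIdeal ∧
        Nat.card (nsmulAddMonoidHom p :
          (F.baseChange (v.adicCompletion ℚ)).toAffine.Point →+ _).ker = 1) \ T₂) := by
      rw [hT', Finset.union_sdiff_self_eq_union]
    rw [hsplit', Finset.prod_union Finset.disjoint_sdiff,
      Finset.prod_eq_one (s := _ \ T₂) (fun v hv ↦ ?_), mul_one]
    · refine Finset.prod_congr rfl fun v _ ↦ ?_
      exact F.natCard_kummerLocalConditionAt_adicCompletion v hpp.ne_zero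
    · rw [Finset.mem_sdiff, Finset.mem_filter] at hv
      rw [F.natCard_kummerLocalConditionAt_adicCompletion v hpp.ne_zero, hv.1.2.2, one_mul,
        natCard_quot_adicCompletionIntegers_eq_one hv.1.2.1]
  · have hvT0 : v ∉ T₂ := fun h ↦ hvT (Finset.mem_union_left _ h)
    rcases hagree₂ v hv hvT0 with h1 | h2
    · exact absurd (Finset.mem_union_right _ (Finset.mem_filter.mpr ⟨hv, h1⟩)) hvT
    · exact h2 c hc

/-! ## §2 The `E ~ F` half with a kill place -/

omit [A₀.IsElliptic] in
/-- **SHAPE F, `E ~ F` half with an abstract kill place.** `E = W` of analytic rank `0`, `E[p]`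
irreducible, `p ∤ #Ш_an(E)`, `p` odd; `θ : E[p] ≃ F[p]` equivariant; `hle : #Sel^(p)(F/ℚ) ≤ p`;
agreement off `T₁` (kind (i) or any kind lemma); `hkill` at `v₀` (files XIV / XVI / XXX); a
rational point `g ∈ F(ℚ)` with `g ∉ p·F(ℚ_{v₀})` (`hcert`, `K̄`-free form); budget `∏_{T₁} ≤ p`.
Then `BSD(E,p)`: `κ(g) ∈ Sel^(p)(F)` restricts non-trivially at `v₀` (file XXII), so
`#Sel^(p)(F) = p` (file XXXVI) and `Sel^(p)(F)` injects at `v₀`; file XXVII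
`bsdp_of_selmerCompanion_agree_kill`. Binders GZK, Cassels–Tate. Not a class theorem; nothing booked.
[cite: MazurRubin2004, §2.3] [cite: Miller2011LMS, §1 and Def. 1.1]
[cite: SilvermanAEC2009, VIII.§2, X.§4 diagram (**), Thm X.4.2] -/
theorem bsdp_of_auxiliary_kill_of_natCard_le
    (hGZK : rank_eq_analyticRank_of_analyticRank_le_one)
    (hCT : exists_casselsTate_pairing (K := ℚ)) (hp2 : p ≠ 2)
    (hr : W.analyticRank = 0) (hirr : Irr W p) (hSha : X11a.ShaAnUnit W p)
    (θ : geomTorsion W (p : ℤ) ≃+ geomTorsion F (p : ℤ))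
    (hθ : ∀ (σ : absoluteGaloisGroup ℚ) (P : geomTorsion W (p : ℤ)), θ (σ • P) = σ • θ P)
    (hle : Nat.card (F.selmerGroup (p : ℤ)) ≤ p)
    (S₁ T₁ : Finset (HeightOneSpectrum (𝓞 ℚ))) (hTS₁ : T₁ ⊆ S₁)
    (hS₁ : ∀ v : HeightOneSpectrum (𝓞 ℚ), v ∉ S₁ →
      F.HasGoodReductionAt v ∧ W.HasGoodReductionAt v ∧ (p : 𝓞 ℚ) ∉ v.asIdeal)
    (hagree₁ : ∀ v ∈ S₁, v ∉ T₁ →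
      ((p : 𝓞 ℚ) ∉ v.asIdeal ∧ Nat.card (nsmulAddMonoidHom p :
          (W.baseChange (v.adicCompletion ℚ)).toAffine.Point →+ _).ker = 1) ∨
      (∀ c ∈ selmerLocalKer W (v.adicCompletion ℚ) (p : ℤ),
        h1Equiv θ hθ c ∈ selmerLocalKer F (v.adicCompletion ℚ) (p : ℤ)))
    {v₀ : HeightOneSpectrum (𝓞 ℚ)}
    (hkill : ∀ c ∈ selmerLocalKer W (v₀.adicCompletion ℚ) (p : ℤ),
      h1Equiv θ hθ c ∈ selmerLocalKer F (v₀.adicCompletion ℚ) (p : ℤ) →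
      galoisCohomology.res (F.torsionGaloisModule (p : ℤ)) (v₀.adicCompletion ℚ) 1
        (h1Equiv θ hθ c) = 0)
    (g : F.toAffine.Point)
    (hcert : ∀ R : (F.baseChange (v₀.adicCompletion ℚ)).toAffine.Point,
      Affine.Point.baseChange (W' := F) ℚ (v₀.adicCompletion ℚ) g ≠ (p : ℤ) • R)
    (hbudget₁ : ∏ v ∈ T₁, (Nat.card (nsmulAddMonoidHom p :
        (W.baseChange (v.adicCompletion ℚ)).toAffine.Point →+ _).ker *
          Nat.card (v.adicCompletionIntegers ℚ ⧸
            Ideal.span {(p : v.adicCompletionIntegers ℚ)})) ≤ p) :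
    BSDp W p := by
  have hpp : p.Prime := hp.out
  have hn0 : (p : ℤ) ≠ 0 := by exact_mod_cast hpp.ne_zero
  have hdiv : ∀ P : geomPoints F, ∃ Q : geomPoints F, (p : ℤ) • Q = P :=
    fun P ↦ F.zsmul_geomPoints_surjective_of_charZero hn0 P
  have hs : kummerMapTorsion F (p : ℤ) hdiv g ∈ F.selmerGroup (p : ℤ) :=
    (mem_selmerGroup_iff F _ _).mpr
      ⟨fun v ↦ kummerMapTorsion_mem_selmerLocalKer F (p : ℤ) hdiv (v.adicCompletion ℚ) g,
        fun w' ↦ kummerMapTorsion_mem_selmerLocalKer F (p : ℤ) hdiv w'.Completion g⟩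
  have hres := res_kummerMapTorsion_ne_zero_of_not_zsmul F p (v₀.adicCompletion ℚ)
    (charZero_adicCompletion v₀) hdiv g hcert
  have hSelF : Nat.card (F.selmerGroup (p : ℤ)) = p :=
    natCard_selmerGroup_eq_prime_of_le F p hle hs (fun h0 ↦ hres (by rw [h0]; exact map_zero _))
  exact bsdp_of_selmerCompanion_agree_kill W F p hGZK hCT hp2 hr hirr hSha θ hθ S₁ T₁ hTS₁ hS₁
    hagree₁ hkill
    (fun d hd hd0 ↦ strict_away_of_generator_certificate F p (v₀.adicCompletion ℚ)
      (charZero_adicCompletion v₀) hSelF hdiv g hcert hd hd0) hbudget₁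

/-! ## §3 The `E ~ F` half at a full-torsion place -/

omit [A₀.IsElliptic] in
/-- **SHAPE F, `E ~ F` half at a FULL-TORSION level-lowering place.** As file XXXVIII
`bsdp_of_auxiliary_of_tateLine_certificates`, with the bound `hle : #Sel^(p)(F/ℚ) ≤ p` taken as
input instead of being derived from file XXVII: the equivariant Tate datum `Φ'` of `E` at `v₀ ∤ p`
(A40 content), `hq : p ∣ q_{v₀} − 1`, the Kummer point `hpt` (lemma G1) and the `δ`-certificate
`hcert` (file XXXII) for a rational point `g ∈ F(ℚ)`; agreement off `T₁ ∪ {v₀}`; budget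
`p·∏_{T₁} ≤ p`. Then `BSD(E,p)`. Binders GZK, Cassels–Tate, Milne I.2.8 at `v₀`. Not a class
theorem; nothing booked. [cite: MazurRubin2004, §2.3] [cite: Miller2011LMS, §1 and Def. 1.1]
[cite: MilneADT2006, Ch. I §2 Thm. 2.8] [cite: SilvermanATAEC1994, Ch. V Thm. 3.1, Thm. 5.3] -/
theorem bsdp_of_auxiliary_tateLine_of_natCard_le
    (hGZK : rank_eq_analyticRank_of_analyticRank_le_one)
    (hCT : exists_casselsTate_pairing (K := ℚ)) (hp2 : p ≠ 2)
    (hr : W.analyticRank = 0) (hirr : Irr W p) (hSha : X11a.ShaAnUnit W p)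
    (hn : (p : ℤ) ≠ 0)
    (θ : geomTorsion W (p : ℤ) ≃+ geomTorsion F (p : ℤ))
    (hθ : ∀ (σ : absoluteGaloisGroup ℚ) (P : geomTorsion W (p : ℤ)), θ (σ • P) = σ • θ P)
    (hle : Nat.card (F.selmerGroup (p : ℤ)) ≤ p)
    (S₁ T₁ : Finset (HeightOneSpectrum (𝓞 ℚ))) (hTS₁ : T₁ ⊆ S₁)
    (hS₁ : ∀ v : HeightOneSpectrum (𝓞 ℚ), v ∉ S₁ →
      F.HasGoodReductionAt v ∧ W.HasGoodReductionAt v ∧ (p : 𝓞 ℚ) ∉ v.asIdeal)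
    {v₀ : HeightOneSpectrum (𝓞 ℚ)} (hpv₀ : (p : 𝓞 ℚ) ∉ v₀.asIdeal) (hv₀S : v₀ ∈ S₁) (hv₀T : v₀ ∉ T₁)
    (hEP₀ : localEulerPoincareCharacteristic (v₀.adicCompletion ℚ))
    (hagree₁ : ∀ v ∈ S₁, v ∉ T₁ → v ≠ v₀ →
      ((p : 𝓞 ℚ) ∉ v.asIdeal ∧ Nat.card (nsmulAddMonoidHom p :
          (W.baseChange (v.adicCompletion ℚ)).toAffine.Point →+ _).ker = 1) ∨
      (∀ c ∈ selmerLocalKer W (v.adicCompletion ℚ) (p : ℤ),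
        h1Equiv θ hθ c ∈ selmerLocalKer F (v.adicCompletion ℚ) (p : ℤ)))
    (Φ' : Additive (AlgebraicClosure (v₀.adicCompletion ℚ))ˣ →+ localPoints W (v₀.adicCompletion ℚ))
    (hequiv' : ∀ (σ : absoluteGaloisGroup (v₀.adicCompletion ℚ))
        (u : (AlgebraicClosure (v₀.adicCompletion ℚ))ˣ),
      σ • Φ' (Additive.ofMul u) = Φ' (Additive.ofMul (Units.map
        (absoluteGaloisGroup.toAlgEquiv _ σ : AlgebraicClosure (v₀.adicCompletion ℚ) →*
          AlgebraicClosure (v₀.adicCompletion ℚ)) u)))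
    (hrat' : ∀ P : localPoints W (v₀.adicCompletion ℚ),
      (∀ σ : absoluteGaloisGroup (v₀.adicCompletion ℚ), σ • P = P) →
      ∃ u : (v₀.adicCompletion ℚ)ˣ, Φ' (Additive.ofMul (Units.map (algebraMap (v₀.adicCompletion ℚ)
        (AlgebraicClosure (v₀.adicCompletion ℚ)) : v₀.adicCompletion ℚ →*
          AlgebraicClosure (v₀.adicCompletion ℚ)) u)) = P)
    (hq : p ∣ Nat.card (IsLocalRing.ResidueField (v₀.adicCompletionIntegers ℚ)) - 1)
    (hpt : ∃ h : localPoints F (v₀.adicCompletion ℚ),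
      (∀ σ : absoluteGaloisGroup (v₀.adicCompletion ℚ),
        ∃ (ζ : (AlgebraicClosure (v₀.adicCompletion ℚ))ˣ) (_ : ζ ^ p = 1)
          (hζ : Φ' (Additive.ofMul ζ) ∈
            AddSubgroup.torsionBy (localPoints W (v₀.adicCompletion ℚ)) (p : ℤ)),
          σ • h - h = pointsMap F (v₀.adicCompletion ℚ)
            ((θ ((W.torsionPointsEquiv (p : ℤ) (E := v₀.adicCompletion ℚ) hn).symm
              ⟨Φ' (Additive.ofMul ζ), hζ⟩) : geomTorsion F (p : ℤ)) : geomPoints F)) ∧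
      ∃ σ₁ : absoluteGaloisGroup (v₀.adicCompletion ℚ), σ₁ • h ≠ h)
    (hbudget₁ : p * ∏ v ∈ T₁, (Nat.card (nsmulAddMonoidHom p :
        (W.baseChange (v.adicCompletion ℚ)).toAffine.Point →+ _).ker *
          Nat.card (v.adicCompletionIntegers ℚ ⧸
            Ideal.span {(p : v.adicCompletionIntegers ℚ)})) ≤ p)
    (g : F.toAffine.Point)
    (hcert : ∀ c : localPoints F (v₀.adicCompletion ℚ),
      (p : ℤ) • c = pointsMap F (v₀.adicCompletion ℚ) (toGeomPoints F g) →
      ∃ σ : absoluteGaloisGroup (v₀.adicCompletion ℚ),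
        ∀ (ζ : (AlgebraicClosure (v₀.adicCompletion ℚ))ˣ), ζ ^ p = 1 →
        ∀ hζ : Φ' (Additive.ofMul ζ) ∈
            AddSubgroup.torsionBy (localPoints W (v₀.adicCompletion ℚ)) (p : ℤ),
          σ • c - c ≠ pointsMap F (v₀.adicCompletion ℚ)
            ((θ ((W.torsionPointsEquiv (p : ℤ) (E := v₀.adicCompletion ℚ) hn).symm
              ⟨Φ' (Additive.ofMul ζ), hζ⟩) : geomTorsion F (p : ℤ)) : geomPoints F)) :
    BSDp W p := by
  have hpp : p.Prime := hp.out
  classical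
  -- `κ(g) ∈ Sel^(p)(F)` restricts non-trivially at `v₀`, so `#Sel^(p)(F) = p`
  have hdiv : ∀ P : geomPoints F, ∃ Q : geomPoints F, (p : ℤ) • Q = P :=
    fun P ↦ F.zsmul_geomPoints_surjective_of_charZero hn P
  have hs' : kummerMapTorsion F (p : ℤ) hdiv g ∈ F.selmerGroup (p : ℤ) :=
    (mem_selmerGroup_iff F _ _).mpr
      ⟨fun v ↦ kummerMapTorsion_mem_selmerLocalKer F (p : ℤ) hdiv (v.adicCompletion ℚ) g,
        fun w' ↦ kummerMapTorsion_mem_selmerLocalKer F (p : ℤ) hdiv w'.Completion g⟩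
  have hnz := not_zsmul_of_tateLine_certificate W F p hn θ Φ' g hcert
  have hres := res_kummerMapTorsion_ne_zero_of_not_zsmul F p (v₀.adicCompletion ℚ)
    (charZero_adicCompletion v₀) hdiv g hnz
  have hSel : Nat.card (F.selmerGroup (p : ℤ)) = p :=
    natCard_selmerGroup_eq_prime_of_le F p hle hs' (fun h0 ↦ hres (by rw [h0]; exact map_zero _))
  have hs : kummerClassTorsion F (p : ℤ) (zsmulRoot F (p : ℤ) hdiv g)
      (zsmul_zsmulRoot_mem F (p : ℤ) hdiv g) ∈ F.selmerGroup (p : ℤ) := by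
    have h := hs'
    rw [kummerMapTorsion_apply] at h
    exact h
  -- the assembly of file XXXV with `A := F`
  set T' := T₁ ∪ S₁.filter (fun v ↦ (p : 𝓞 ℚ) ∉ v.asIdeal ∧ Nat.card (nsmulAddMonoidHom p :
      (W.baseChange (v.adicCompletion ℚ)).toAffine.Point →+ _).ker = 1 ∧ v ≠ v₀) with hT'
  have hT'S : T' ⊆ S₁ := Finset.union_subset hTS₁ (Finset.filter_subset _ _)
  have hv₀T' : v₀ ∉ T' := by
    rw [hT', Finset.mem_union, Finset.mem_filter, not_or]
    exact ⟨hv₀T, fun h ↦ h.2.2.2 rfl⟩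
  have hle' := natCard_selmerGroup_le_of_congr_of_le_off_insert_strict F W hp2 θ hθ S₁ T' hv₀S
    hv₀T' hT'S hS₁ (fun v hv hvT hvv₀ c hc ↦ ?_)
    (relIndex_map_selmerLocalKer_le_of_tateLine W F p hEP₀ hpv₀ hn θ hθ Φ' hequiv' hrat'
      (units_map_eq_self_of_pow_eq_one_of_dvd p hpv₀ hq) hpt)
    (fun c hc hsel ↦ h1Equiv_eq_zero_of_selmer_of_tateLine_certificate F v₀ W hn θ hθ Φ'
      hequiv' hrat' hSel (zsmul_zsmulRoot_mem F (p : ℤ) hdiv g) hs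
      (fun c' hc' ↦ hcert c' (by rw [hc', zsmul_zsmulRoot])) hc hsel)
  · refine bsdp_of_natCard_selmerGroup_le W p hGZK hCT hr hirr hSha (le_trans hle' ?_)
    refine le_trans (le_of_eq ?_) hbudget₁
    congr 1
    have hsplit' : T' = T₁ ∪ (S₁.filter (fun v ↦ (p : 𝓞 ℚ) ∉ v.asIdeal ∧
        Nat.card (nsmulAddMonoidHom p :
          (W.baseChange (v.adicCompletion ℚ)).toAffine.Point →+ _).ker = 1 ∧ v ≠ v₀) \ T₁) := by
      rw [hT', Finset.union_sdiff_self_eq_union]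
    rw [hsplit', Finset.prod_union Finset.disjoint_sdiff,
      Finset.prod_eq_one (s := _ \ T₁) (fun v hv ↦ ?_), mul_one]
    · refine Finset.prod_congr rfl fun v _ ↦ ?_
      exact W.natCard_kummerLocalConditionAt_adicCompletion v hpp.ne_zero
    · rw [Finset.mem_sdiff, Finset.mem_filter] at hv
      rw [W.natCard_kummerLocalConditionAt_adicCompletion v hpp.ne_zero, hv.1.2.2.1, one_mul,
        natCard_quot_adicCompletionIntegers_eq_one hv.1.2.1]
  · have hvT0 : v ∉ T₁ := fun h ↦ hvT (Finset.mem_union_left _ h)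
    rcases hagree₁ v hv hvT0 hvv₀ with h1 | h2
    · exact absurd (Finset.mem_union_right _ (Finset.mem_filter.mpr ⟨hv, h1.1, h1.2, hvv₀⟩)) hvT
    · exact h2 c hc

end Summit.BirchSwinnertonDyer.Rank1Residual.X11a.SelmerCompanion

end
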